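import Mathlib.Analysis.Calculus.AddTorsor.AffineMap
import Mathlib.Analysis.Calculus.BumpFunction.InnerProduct
import Mathlib.Analysis.Calculus.FDeriv.Affine
import Mathlib.Analysis.Calculus.FDeriv.Comp
import Literature.Analysis.Convexity.ComplexTransport
import Literature.Topology.FourManifolds.PLStructures
import Literature.Topology.FourManifolds.PLManifoldProofs
import Literature.Topology.FourManifolds.PLManifoldComp
import HarnessLib

/-!
# Towards `PLStructures.lean` (spc4.S35): piecewise-differentiable maps, first properties

Sibling proof file of `Literature/Topology/FourManifolds/PLStructures.lean`, whose named fact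
`Literature.Topology.FourManifolds.exists_isManifold_isWhiteheadCompatible_four` (every PL
4-manifold carries a Whitehead-compatible smoothing) is the smoothing theorem for PL manifolds
in dimension `4`: Hirsch–Mazur, *Smoothings of piecewise linear manifolds*, Ann. of Math.
Studies 80 (1974), Part II, §5, Thm 5.3 and the remark following it (the obstructions to
smoothing a PL manifold `M` lie in `H^{i+1}(M; πᵢ(PL/O))`, and `PL/O` is `6`-connected), with
Part I, §3 for the notion of smoothing (`IsWhiteheadCompatible`); equivalently Munkres,
*Obstructions to imposing differentiable structures*, Illinois J. Math. 8 (1964), with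
`Γ₁ = Γ₂ = Γ₃ = 0`. That theorem rests on a PL/PD toolkit (subdivisions, regular
neighbourhoods, the product and concordance extension theorems, obstruction theory, `Γ₃ = 0`)
none of which exists in Mathlib or in this library; the fact therefore stays a named fact for
now, and this file only lands the first, elementary layer that any proof of it — and any *use*
of `IsWhiteheadCompatible` — needs, all as closed theorems:

* `isPDOn_of_contDiffOn`, `isPDOn_of_contDiff`, `isPDOn_id`: a `C^∞` map with injective
  derivative on an open set (in particular a local diffeomorphism, the identity) is piecewise
  differentiable of maximal rank there (Munkres, *Elementary differential topology* (1966), §8: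
  smooth immersions of simplices are the building blocks of PD maps). The simplex
  neighbourhoods come from `PLManifoldProofs` (`exists_simplicialComplex_space_mem_nhds_subset`);
  the global `C^∞` representative required by `IsPDOn` is produced by cutting off with a smooth
  bump function (`exists_contDiff_eventuallyEq_of_contDiffOn`).
* `injective_fderiv_of_mem_contDiffGroupoid`: members of `contDiffGroupoid ∞ (𝓡 n)` (smooth
  local diffeomorphisms of `ℝⁿ`) have injective derivative on their source (chain rule against
  the smooth inverse).
* `isWhiteheadCompatible_self`: a `C^∞` atlas is Whitehead compatible with itself — its
  transition maps are PD; in particular the model space `ℝⁿ`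
  (`isWhiteheadCompatible_euclideanSpace`), and the conclusion of spc4.S35 holds outright for
  every PL manifold whose PL atlas happens to be a `C^∞` atlas as well
  (`exists_isManifold_isWhiteheadCompatible_of_isManifold`: open subsets of `ℝ⁴`, affine tori,
  …). This is the trivially-smoothable case only; the general case is the smoothing theorem
  above.

* `IsPDOn.mono`, `IsPDOn.congr`, `IsPDOn.of_forall_exists`, `IsPDOn.continuousOn` and the
  shrinking lemma `exists_simplicialComplex_faces_subset_of_mem_nhds` (a finite complex
  neighbourhood of `a` can be shrunk into any neighbourhood of `a` with every new simplex inside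
  an old one): the elementary API of PD maps, parallel to that of `IsPLOn`.
* `IsPDOn.contDiffOn_comp`: post-composing a PD map with a `C^∞` map of maximal rank gives a PD
  map (Munkres (1966), §8); hence `IsWhiteheadCompatible.of_subset_maximalAtlas`: Whitehead
  compatibility of `cPL` with a smooth atlas `cDIFF` passes to every atlas whose charts lie in the
  `C^∞` maximal atlas of `cDIFF` — it is a property of the smooth *structure*, not of the atlas.
* `IsPDOn.comp_isPLOn`: pre-composing a PD map with an injective PL map on an open set (a PL
  homeomorphism) gives a PD map — take the chain triangulation of a small simplex adapted to the
  *top-dimensional* simplices of the PL complex and to the PD complex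
  (`exists_simplicialComplex_forall_subset_mapsTo`, on top of the sign-arrangement
  triangulation behind `PLManifoldComp`; purity of interior points
  `exists_mem_faces_affineSpan_eq_top_of_mem_interior`; `injective_linear_of_injOn`). Hence
  `isPDOn_of_isPLOn_injOn` (PL homeomorphisms are PD), `IsPDOn.comp_of_mem_plGroupoid`, and
  `IsWhiteheadCompatible.of_subset_plMaximalAtlas` / `.of_subset_maximalAtlases`: Whitehead
  compatibility passes to every atlas inside the maximal PL atlas of `cPL` — it is a relation
  between the PL *structure* and the smooth *structure* (Hirsch–Mazur (1974), Part I, §3: the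
  definitions of a smoothing via all PL charts and via one triangulation agree).

No definitions and no named facts are introduced (D-0026).
-/

open scoped Manifold ContDiff Topology
open Set Function Filter

noncomputable section

namespace Literature.Topology.FourManifolds

open _root_.Topology

variable {n : ℕ}

/-! ### Simplex neighbourhoods and smooth cut-offs -/

section Local

/-- **Simplex neighbourhoods inside a given neighbourhood.** Every neighbourhood `v` of a point
`a ∈ ℝⁿ` contains the underlying space of a *finite* simplicial complex which is itself a
neighbourhood of `a` (a small `n`-simplex around `a` with its faces, shrunk into `v`).
Rourke–Sanderson (1972), 2.2 and 2.11–2.12; obtained from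
`exists_simplicialComplex_space_subset_of_mem_nhds` of `PLManifoldProofs`. [folklore] -/
theorem exists_simplicialComplex_space_mem_nhds_subset {a : EuclideanSpace ℝ (Fin n)}
    {v : Set (EuclideanSpace ℝ (Fin n))} (hv : v ∈ 𝓝 a) :
    ∃ K : Geometry.SimplicialComplex ℝ (EuclideanSpace ℝ (Fin n)),
      K.faces.Finite ∧ K.space ∈ 𝓝 a ∧ K.space ⊆ v := by
  obtain ⟨S, hS, hnhds⟩ := exists_affineIndependent_convexHull_mem_nhds a
  have hne : S ≠ ∅ := by
    rintro rfl
    have : a ∈ convexHull ℝ ((∅ : Finset (EuclideanSpace ℝ (Fin n))) :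
        Set (EuclideanSpace ℝ (Fin n))) := mem_of_mem_nhds hnhds
    simp at this
  obtain ⟨K, hK⟩ := exists_simplicialComplex_faces_iff_subset S hS
  have hKa : K.space ∈ 𝓝 a := by
    rw [space_eq_convexHull_of_faces_iff_subset hK hne]
    exact hnhds
  obtain ⟨K', hfin', hK'a, hK'v, -⟩ :=
    exists_simplicialComplex_space_subset_of_mem_nhds (faces_finite_of_faces_iff_subset hK) hKa
      (f := (id : EuclideanSpace ℝ (Fin n) → EuclideanSpace ℝ (Fin n))) (G := Set.univ)
      (fun _ _ => ⟨id, mem_univ _, fun _ _ => rfl⟩) hv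
  exact ⟨K', hfin', hK'a, hK'v⟩

/-- **Smooth cut-off.** If `f` is `C^∞` on an open set `u ∋ a` of `ℝⁿ`, there is a globally
`C^∞` map `g : ℝⁿ → ℝⁿ` agreeing with `f` on a neighbourhood of `a`: multiply `f` by a smooth
bump function which is `1` near `a` and supported inside `u`. [folklore] -/
theorem exists_contDiff_eventuallyEq_of_contDiffOn
    {f : EuclideanSpace ℝ (Fin n) → EuclideanSpace ℝ (Fin n)} {u : Set (EuclideanSpace ℝ (Fin n))}
    (hu : IsOpen u) (hf : ContDiffOn ℝ ∞ f u) {a : EuclideanSpace ℝ (Fin n)} (ha : a ∈ u) :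
    ∃ g : EuclideanSpace ℝ (Fin n) → EuclideanSpace ℝ (Fin n), ContDiff ℝ ∞ g ∧ f =ᶠ[𝓝 a] g := by
  obtain ⟨r, hr0, hru⟩ := Metric.isOpen_iff.1 hu a ha
  let φ : ContDiffBump a := ⟨r / 4, r / 2, by positivity, by linarith⟩
  refine ⟨fun x => φ x • f x, ?_, ?_⟩
  · rw [contDiff_iff_contDiffAt]
    intro x
    by_cases hx : x ∈ u
    · exact φ.contDiffAt.smul (hf.contDiffAt (hu.mem_nhds hx))
    · have hx' : x ∉ tsupport φ := by
        rw [φ.tsupport_eq]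
        intro hx'
        exact hx (hru (Metric.closedBall_subset_ball (by show r / 2 < r; linarith) hx'))
      have h0 : (φ : EuclideanSpace ℝ (Fin n) → ℝ) =ᶠ[𝓝 x] 0 :=
        notMem_tsupport_iff_eventuallyEq.1 hx'
      have h0' : (fun y => φ y • f y) =ᶠ[𝓝 x] fun _ => 0 := by
        filter_upwards [h0] with y hy
        simp [hy]
      exact contDiffAt_const.congr_of_eventuallyEq h0'
  · filter_upwards [φ.eventuallyEq_one] with y hy
    simp [hy]

end Local

/-! ### Smooth immersions are PD -/

section PDMaps

/-- **Smooth maps of maximal rank are PD** (Munkres (1966), §8). If `f : ℝⁿ → ℝⁿ` is `C^∞` on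
the open set `u` with injective derivative at every point of `u`, then `f` is piecewise
differentiable of maximal rank on `u` in the sense of `IsPDOn`: around `a ∈ u` take a finite
simplicial complex neighbourhood inside an open set on which `f` agrees with a global `C^∞` map
`g` (`exists_contDiff_eventuallyEq_of_contDiffOn`); on each of its simplices `f = g` and
`fderiv g = fderiv f` is injective. [cite: Munkres1966, §8] -/
theorem isPDOn_of_contDiffOn {f : EuclideanSpace ℝ (Fin n) → EuclideanSpace ℝ (Fin n)}
    {u : Set (EuclideanSpace ℝ (Fin n))} (hu : IsOpen u) (hf : ContDiffOn ℝ ∞ f u)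
    (hinj : ∀ x ∈ u, Injective (fderiv ℝ f x)) : IsPDOn n f u := by
  intro a ha
  obtain ⟨g, hg, hfg⟩ := exists_contDiff_eventuallyEq_of_contDiffOn hu hf ha
  obtain ⟨t, hts, hto, hat⟩ := mem_nhds_iff.1 (inter_mem hfg (hu.mem_nhds ha))
  obtain ⟨K, hfin, hKa, hKt⟩ := exists_simplicialComplex_space_mem_nhds_subset (hto.mem_nhds hat)
  refine ⟨K, hfin, hKa, fun x hx => (hts (hKt hx)).2, fun s hs => ⟨g, hg, fun x hx =>
    (hts (hKt (Geometry.SimplicialComplex.convexHull_subset_space hs hx))).1, fun x hx => ?_⟩⟩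
  have hxt : x ∈ t := hKt (Geometry.SimplicialComplex.convexHull_subset_space hs hx)
  have hgf : g =ᶠ[𝓝 x] f := by
    filter_upwards [hto.mem_nhds hxt] with y hy
    exact ((hts hy).1).symm
  rw [hgf.fderiv_eq]
  exact hinj x (hts hxt).2

/-- A globally `C^∞` map with injective derivative on an open set `u` is PD on `u`
(Munkres (1966), §8). [cite: Munkres1966, §8] -/
theorem isPDOn_of_contDiff {f : EuclideanSpace ℝ (Fin n) → EuclideanSpace ℝ (Fin n)}
    {u : Set (EuclideanSpace ℝ (Fin n))} (hu : IsOpen u) (hf : ContDiff ℝ ∞ f)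
    (hinj : ∀ x ∈ u, Injective (fderiv ℝ f x)) : IsPDOn n f u :=
  isPDOn_of_contDiffOn hu hf.contDiffOn hinj

/-- The identity of `ℝⁿ` is PD on every open set (Munkres (1966), §8). [cite: Munkres1966, §8] -/
theorem isPDOn_id {u : Set (EuclideanSpace ℝ (Fin n))} (hu : IsOpen u) : IsPDOn n id u :=
  isPDOn_of_contDiff hu contDiff_id fun x _ => by
    simpa only [fderiv_id, ContinuousLinearMap.coe_id'] using injective_id

end PDMaps

/-! ### Smooth atlases are Whitehead compatible with themselves -/

section SmoothAtlas

/-- A member of the `C^∞` groupoid of `ℝⁿ` (model `𝓡 n`) is `C^∞` on its source, and its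
inverse is `C^∞` on its target (unfolding of Mathlib's `contDiffGroupoid` for the
self-model). [folklore] -/
theorem contDiffOn_of_mem_contDiffGroupoid_euclidean
    {e : OpenPartialHomeomorph (EuclideanSpace ℝ (Fin n)) (EuclideanSpace ℝ (Fin n))}
    (he : e ∈ contDiffGroupoid ∞ (𝓡 n)) :
    ContDiffOn ℝ ∞ e e.source ∧ ContDiffOn ℝ ∞ e.symm e.target := by
  rw [contDiffGroupoid, mem_groupoid_of_pregroupoid] at he
  simpa only [contDiffPregroupoid, modelWithCornersSelf_coe, modelWithCornersSelf_coe_symm,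
    Function.comp_id, Function.id_comp, range_id, preimage_id, inter_univ] using he

/-- **Local diffeomorphisms have injective derivative.** If `e` belongs to the `C^∞` groupoid
of `ℝⁿ`, then `fderiv ℝ e x` is injective at every `x ∈ e.source`: by the chain rule
`fderiv e.symm (e x) ∘ fderiv e x = fderiv (e.symm ∘ e) x = id`. [folklore] -/
theorem injective_fderiv_of_mem_contDiffGroupoid
    {e : OpenPartialHomeomorph (EuclideanSpace ℝ (Fin n)) (EuclideanSpace ℝ (Fin n))}
    (he : e ∈ contDiffGroupoid ∞ (𝓡 n)) {x : EuclideanSpace ℝ (Fin n)} (hx : x ∈ e.source) :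
    Injective (fderiv ℝ e x) := by
  obtain ⟨h₁, h₂⟩ := contDiffOn_of_mem_contDiffGroupoid_euclidean he
  have hd₁ : DifferentiableAt ℝ e x :=
    (h₁.contDiffAt (e.open_source.mem_nhds hx)).differentiableAt (by simp)
  have hd₂ : DifferentiableAt ℝ e.symm (e x) :=
    (h₂.contDiffAt (e.open_target.mem_nhds (e.map_source hx))).differentiableAt (by simp)
  have hcomp : HasFDerivAt (e.symm ∘ e) ((fderiv ℝ e.symm (e x)).comp (fderiv ℝ e x)) x :=
    hd₂.hasFDerivAt.comp x hd₁.hasFDerivAt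
  have hid : HasFDerivAt (e.symm ∘ e) (ContinuousLinearMap.id ℝ (EuclideanSpace ℝ (Fin n))) x :=
    (hasFDerivAt_id x).congr_of_eventuallyEq
      ((e.eventually_left_inverse hx).mono fun y hy => by simpa using hy)
  have heq : (fderiv ℝ e.symm (e x)).comp (fderiv ℝ e x) =
      ContinuousLinearMap.id ℝ (EuclideanSpace ℝ (Fin n)) :=
    hcomp.unique hid
  intro v w hvw
  have h := congrArg (fderiv ℝ e.symm (e x)) hvw
  rw [← ContinuousLinearMap.comp_apply, ← ContinuousLinearMap.comp_apply, heq] at h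
  simpa using h

/-- **A smooth atlas is Whitehead compatible with itself.** For a `C^∞` manifold `(M, c)`
modelled on `ℝⁿ`, every transition map `e' ∘ e.symm` (`e, e' ∈ atlas`) is a `C^∞` local
diffeomorphism, hence piecewise differentiable of maximal rank on its domain
(`isPDOn_of_contDiffOn`, `injective_fderiv_of_mem_contDiffGroupoid`):
`IsWhiteheadCompatible n M c c`. (Munkres (1966), §8: diffeomorphisms are PD homeomorphisms.)
[cite: Munkres1966, §8] -/
theorem isWhiteheadCompatible_self (M : Type*) [TopologicalSpace M]
    [c : ChartedSpace (EuclideanSpace ℝ (Fin n)) M] [IsManifold (𝓡 n) ∞ M] :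
    IsWhiteheadCompatible n M c c := by
  intro e he e' he'
  have hmem : e.symm.trans e' ∈ contDiffGroupoid ∞ (𝓡 n) := HasGroupoid.compatible he he'
  exact isPDOn_of_contDiffOn (e.symm.trans e').open_source
    (contDiffOn_of_mem_contDiffGroupoid_euclidean hmem).1
    fun x hx => injective_fderiv_of_mem_contDiffGroupoid hmem hx

variable (n) in
/-- The model space `ℝⁿ`, with its one-chart atlas regarded both as a PL atlas
(`instIsPLManifoldEuclideanSpace`) and as a `C^∞` atlas, is Whitehead compatible with itself:
the standard PL structure of `ℝⁿ` is a smooth triangulation of the standard smooth structure.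
[folklore] -/
theorem isWhiteheadCompatible_euclideanSpace :
    IsWhiteheadCompatible n (EuclideanSpace ℝ (Fin n)) inferInstance inferInstance :=
  isWhiteheadCompatible_self (EuclideanSpace ℝ (Fin n))

universe u

/-- **The trivially smoothable case of spc4.S35.** If the given atlas `c` of a manifold `M`
modelled on `ℝⁿ` is a `C^∞` atlas, then `M` carries a `C^∞` structure Whitehead compatible
with `c`, namely `c` itself (`isWhiteheadCompatible_self`). When `c` is moreover a PL atlas
(e.g. `ℝ⁴`, its open subsets, affine tori: atlases with affine transition maps) this is the
conclusion of `exists_isManifold_isWhiteheadCompatible_four` for `(M, c)`; the general PL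
4-manifold requires the smoothing theorem of Hirsch–Mazur, Part II, §5, Thm 5.3 (with `PL/O`
`6`-connected), which is not proved here. [cite: HirschMazur1974, Part II, §5, Thm 5.3] -/
theorem exists_isManifold_isWhiteheadCompatible_of_isManifold (M : Type u) [TopologicalSpace M]
    [c : ChartedSpace (EuclideanSpace ℝ (Fin n)) M] [IsManifold (𝓡 n) ∞ M] :
    ∃ cDIFF : ChartedSpace (EuclideanSpace ℝ (Fin n)) M,
      @IsManifold ℝ _ _ _ _ _ _ (𝓡 n) ∞ M _ cDIFF ∧ IsWhiteheadCompatible n M c cDIFF :=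
  ⟨c, ‹_›, isWhiteheadCompatible_self M⟩

end SmoothAtlas

/-! ### Elementary API of PD maps -/

section PDMapsAPI

/-- **Shrinking a finite complex into a neighbourhood, simplexwise.** If the underlying space of
a finite simplicial complex `K` is a neighbourhood of `a`, then every neighbourhood `v` of `a`
contains the underlying space of a finite simplicial complex `K'`, again a neighbourhood of `a`,
each of whose closed simplices lies in a closed simplex of `K` (the closed star of `a` shrunk
towards `a`; from `exists_simplicialComplex_space_subset_of_mem_nhds` of `PLManifoldProofs`,
applied to the `Prop`-valued pieces `x ↦ x ∈ σ`). Rourke–Sanderson (1972), 2.11–2.12.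
[folklore] -/
theorem exists_simplicialComplex_faces_subset_of_mem_nhds {E : Type*} [NormedAddCommGroup E]
    [NormedSpace ℝ E] {K : Geometry.SimplicialComplex ℝ E} (hfin : K.faces.Finite) {a : E}
    (ha : K.space ∈ 𝓝 a) {v : Set E} (hv : v ∈ 𝓝 a) :
    ∃ K' : Geometry.SimplicialComplex ℝ E, K'.faces.Finite ∧ K'.space ∈ 𝓝 a ∧ K'.space ⊆ v ∧
      ∀ s' ∈ K'.faces, ∃ s ∈ K.faces, convexHull ℝ (s' : Set E) ⊆ convexHull ℝ (s : Set E) := by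
  obtain ⟨K', hfin', hK'a, hK'v, hK'⟩ :=
    exists_simplicialComplex_space_subset_of_mem_nhds hfin ha (F := Prop) (f := fun _ => True)
      (G := {g | ∃ s ∈ K.faces, ∀ x, g x → x ∈ convexHull ℝ (s : Set E)})
      (fun s hs => ⟨fun x => x ∈ convexHull ℝ (s : Set E), ⟨s, hs, fun _ hx => hx⟩,
        fun _ hx => (eq_true hx).symm⟩) hv
  refine ⟨K', hfin', hK'a, hK'v, fun s' hs' => ?_⟩
  obtain ⟨g, ⟨s, hs, hg⟩, hfg⟩ := hK' s' hs'
  exact ⟨s, hs, fun x hx => hg x (of_eq_true (hfg hx).symm)⟩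

/-- Restriction of a PD map to an open subset is PD: shrink the local complex into the subset,
every new simplex lying in an old one, so that the smooth pieces restrict
(`exists_simplicialComplex_faces_subset_of_mem_nhds`). Munkres (1966), §8. [folklore] -/
theorem IsPDOn.mono {f : EuclideanSpace ℝ (Fin n) → EuclideanSpace ℝ (Fin n)}
    {u v : Set (EuclideanSpace ℝ (Fin n))} (hf : IsPDOn n f u) (hv : IsOpen v) (hvu : v ⊆ u) :
    IsPDOn n f v := by
  intro a hav
  obtain ⟨K, hfin, hKa, -, hK⟩ := hf a (hvu hav)
  obtain ⟨K', hfin', hK'a, hK'v, hK'⟩ :=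
    exists_simplicialComplex_faces_subset_of_mem_nhds hfin hKa (hv.mem_nhds hav)
  refine ⟨K', hfin', hK'a, hK'v, fun s' hs' => ?_⟩
  obtain ⟨s, hs, hss⟩ := hK' s' hs'
  obtain ⟨g, hg, hfg, hinj⟩ := hK s hs
  exact ⟨g, hg, hfg.mono hss, fun x hx => hinj x (hss hx)⟩

/-- PD-ness is local by construction: if every `a ∈ u` lies in some `v ⊆ u` on which `f` is
PD, then `f` is PD on `u`. [folklore] -/
theorem IsPDOn.of_forall_exists {f : EuclideanSpace ℝ (Fin n) → EuclideanSpace ℝ (Fin n)}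
    {u : Set (EuclideanSpace ℝ (Fin n))}
    (h : ∀ a ∈ u, ∃ v ⊆ u, a ∈ v ∧ IsPDOn n f v) : IsPDOn n f u := by
  intro a ha
  obtain ⟨v, hvu, hav, hv⟩ := h a ha
  obtain ⟨K, hfin, hnhds, hsub, hK⟩ := hv a hav
  exact ⟨K, hfin, hnhds, hsub.trans hvu, hK⟩

/-- PD-ness only depends on the values of the map on the set: if `g = f` on `u` and `f` is PD
on `u` then so is `g`. [folklore] -/
theorem IsPDOn.congr {f g : EuclideanSpace ℝ (Fin n) → EuclideanSpace ℝ (Fin n)}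
    {u : Set (EuclideanSpace ℝ (Fin n))} (h : ∀ x ∈ u, g x = f x) (hf : IsPDOn n f u) :
    IsPDOn n g u := by
  intro a ha
  obtain ⟨K, hfin, hnhds, hsub, hK⟩ := hf a ha
  refine ⟨K, hfin, hnhds, hsub, fun s hs => ?_⟩
  obtain ⟨g', hg', hfg', hinj⟩ := hK s hs
  refine ⟨g', hg', fun x hx => ?_, hinj⟩
  rw [h x (hsub (Geometry.SimplicialComplex.convexHull_subset_space hs hx))]
  exact hfg' hx

/-- A PD map is continuous on its domain: locally it is a map which is smooth (hence
continuous) on each of finitely many closed simplices covering a neighbourhood.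
Munkres (1966), §8. [folklore] -/
theorem IsPDOn.continuousOn {f : EuclideanSpace ℝ (Fin n) → EuclideanSpace ℝ (Fin n)}
    {u : Set (EuclideanSpace ℝ (Fin n))} (hf : IsPDOn n f u) : ContinuousOn f u := by
  intro a ha
  obtain ⟨K, hfin, hnhds, -, hK⟩ := hf a ha
  have hcont : ContinuousOn f K.space := by
    have : K.space = ⋃ s : K.faces,
        convexHull ℝ ((s : Finset (EuclideanSpace ℝ (Fin n))) :
          Set (EuclideanSpace ℝ (Fin n))) := by
      simp only [Geometry.SimplicialComplex.space, biUnion_eq_iUnion]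
    rw [this]
    haveI : Finite K.faces := hfin.to_subtype
    refine (locallyFinite_of_finite _).continuousOn_iUnion (fun s => ?_) (fun s => ?_)
    · exact (s.1.finite_toSet).isClosed_convexHull ℝ
    · obtain ⟨g, hg, hfg, -⟩ := hK s.1 s.2
      exact hg.continuous.continuousOn.congr hfg
  exact (hcont.continuousAt hnhds).continuousWithinAt

/-- **PD followed by smooth of maximal rank is PD** (Munkres (1966), §8). Let `f` be PD on
`u`, let `φ` be `C^∞` with injective derivative on the open set `v`, and let `w ⊆ u` be an open
set mapped into `v` by `f`. Then `φ ∘ f` is PD on `w`: around `a ∈ w`, replace `φ` by a global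
`C^∞` map `ψ` agreeing with it near `f a` (`exists_contDiff_eventuallyEq_of_contDiffOn`), shrink
the local complex of `f` into the preimage of that neighbourhood (`IsPDOn.mono`,
`IsPDOn.continuousOn`), and use the pieces `ψ ∘ g` (chain rule). [cite: Munkres1966, §8] -/
theorem IsPDOn.contDiffOn_comp {f φ : EuclideanSpace ℝ (Fin n) → EuclideanSpace ℝ (Fin n)}
    {u v w : Set (EuclideanSpace ℝ (Fin n))} (hf : IsPDOn n f u) (hv : IsOpen v)
    (hφ : ContDiffOn ℝ ∞ φ v) (hφinj : ∀ y ∈ v, Injective (fderiv ℝ φ y)) (hw : IsOpen w)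
    (hwu : w ⊆ u) (hwv : MapsTo f w v) : IsPDOn n (φ ∘ f) w := by
  intro a ha
  obtain ⟨ψ, hψ, hφψ⟩ := exists_contDiff_eventuallyEq_of_contDiffOn hv hφ (hwv ha)
  obtain ⟨t, hts, hto, hat⟩ := mem_nhds_iff.1 (inter_mem hφψ (hv.mem_nhds (hwv ha)))
  -- the open set `w ∩ f ⁻¹' t ∋ a`, on which `φ ∘ f = ψ ∘ f`
  have hfw : ContinuousOn f w := hf.continuousOn.mono hwu
  have hopen : IsOpen (w ∩ f ⁻¹' t) := hfw.isOpen_inter_preimage hw hto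
  obtain ⟨K, hfin, hKa, hKsub, hK⟩ :=
    hf.mono hopen (inter_subset_left.trans hwu) a ⟨ha, hat⟩
  refine ⟨K, hfin, hKa, hKsub.trans inter_subset_left, fun s hs => ?_⟩
  obtain ⟨g, hg, hfg, hinj⟩ := hK s hs
  have hst : ∀ x ∈ convexHull ℝ (s : Set (EuclideanSpace ℝ (Fin n))), f x ∈ t := fun x hx =>
    (hKsub (Geometry.SimplicialComplex.convexHull_subset_space hs hx)).2
  refine ⟨ψ ∘ g, hψ.comp hg, fun x hx => ?_, fun x hx => ?_⟩
  · show φ (f x) = ψ (g x)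
    rw [← hfg hx]
    exact (hts (hst x hx)).1
  · have hgx : g x = f x := (hfg hx).symm
    have hψφ : ψ =ᶠ[𝓝 (g x)] φ := by
      rw [hgx]
      filter_upwards [hto.mem_nhds (hst x hx)] with y hy
      exact ((hts hy).1).symm
    have hφx : Injective (fderiv ℝ φ (g x)) := by
      rw [hgx]
      exact hφinj (f x) (hts (hst x hx)).2
    rw [fderiv_comp x (hψ.contDiffAt.differentiableAt (by simp))
      (hg.contDiffAt.differentiableAt (by simp)), hψφ.fderiv_eq, ContinuousLinearMap.coe_comp]
    exact hφx.comp (hinj x hx)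

end PDMapsAPI

/-! ### Whitehead compatibility is a property of the smooth structure -/

section MaximalAtlas

/-- **Whitehead compatibility only depends on the smooth structure.** Let `cPL` be Whitehead
compatible with the atlas `cDIFF` on `M`, and let `cDIFF'` be another atlas all of whose charts
lie in the `C^∞` maximal atlas of `cDIFF` (e.g. any atlas defining the same `C^∞` structure).
Then `cPL` is Whitehead compatible with `cDIFF'`: locally `e'' ∘ e.symm =
(e'' ∘ e'.symm) ∘ (e' ∘ e.symm)` with `e'` a chart of `cDIFF`, a smooth local diffeomorphism
after a PD map (`IsPDOn.contDiffOn_comp`, `injective_fderiv_of_mem_contDiffGroupoid`).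
Munkres (1966), §8 (a smooth triangulation of a differentiable manifold is one of the
differentiable structure). All three atlases are passed explicitly. [cite: Munkres1966, §8] -/
theorem IsWhiteheadCompatible.of_subset_maximalAtlas {M : Type*} [TopologicalSpace M]
    {cPL cDIFF cDIFF' : ChartedSpace (EuclideanSpace ℝ (Fin n)) M}
    (h : IsWhiteheadCompatible n M cPL cDIFF)
    (h' : @atlas (EuclideanSpace ℝ (Fin n)) _ M _ cDIFF' ⊆
      @StructureGroupoid.maximalAtlas (EuclideanSpace ℝ (Fin n)) M _ _ cDIFF
        (contDiffGroupoid ∞ (𝓡 n))) :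
    IsWhiteheadCompatible n M cPL cDIFF' := by
  intro e he e'' he''
  refine IsPDOn.of_forall_exists fun x hx => ?_
  -- `x ∈ e.target`, `e.symm x ∈ e''.source`; interpose the `cDIFF`-chart `e'` at `e.symm x`
  have hx₁ : x ∈ e.target := hx.1
  have hx₂ : e.symm x ∈ e''.source := hx.2
  obtain ⟨e', he', hxe'⟩ : ∃ e' ∈ @atlas (EuclideanSpace ℝ (Fin n)) _ M _ cDIFF,
      e.symm x ∈ e'.source :=
    ⟨@chartAt (EuclideanSpace ℝ (Fin n)) _ M _ cDIFF (e.symm x),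
      @chart_mem_atlas (EuclideanSpace ℝ (Fin n)) M _ _ cDIFF (e.symm x),
      @mem_chart_source (EuclideanSpace ℝ (Fin n)) M _ _ cDIFF (e.symm x)⟩
  have hT₁ : IsPDOn n (e' ∘ e.symm) (e.symm.trans e').source := h e he e' he'
  have hT₂ : e'.symm.trans e'' ∈ contDiffGroupoid ∞ (𝓡 n) := (h' he'' e' he').2
  -- the open set on which the factorisation holds
  refine ⟨((e.symm.trans e').trans (e'.symm.trans e'')).source, ?_, ?_, ?_⟩
  · intro y hy
    rw [OpenPartialHomeomorph.trans_source] at hy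
    have hy₁ : y ∈ (e.symm.trans e').source := hy.1
    have hy₂ : (e.symm.trans e') y ∈ (e'.symm.trans e'').source := hy.2
    rw [OpenPartialHomeomorph.trans_source] at hy₁ hy₂
    refine ⟨hy₁.1, ?_⟩
    have h₃ : e'.symm (e' (e.symm y)) ∈ e''.source := hy₂.2
    rwa [e'.left_inv hy₁.2] at h₃
  · simp only [OpenPartialHomeomorph.trans_source, mem_inter_iff, mem_preimage,
      OpenPartialHomeomorph.coe_trans, comp_apply, OpenPartialHomeomorph.symm_source]
    refine ⟨⟨hx₁, hxe'⟩, OpenPartialHomeomorph.map_source _ hxe', ?_⟩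
    rw [e'.left_inv hxe']
    exact hx₂
  · have hcomp : IsPDOn n ((e'.symm.trans e'') ∘ (e.symm.trans e'))
        ((e.symm.trans e').trans (e'.symm.trans e'')).source :=
      hT₁.contDiffOn_comp (e'.symm.trans e'').open_source
        (contDiffOn_of_mem_contDiffGroupoid_euclidean hT₂).1
        (fun y hy => injective_fderiv_of_mem_contDiffGroupoid hT₂ hy)
        (OpenPartialHomeomorph.open_source _)
        (by rw [OpenPartialHomeomorph.trans_source]; exact inter_subset_left)
        (by
          intro y hy
          rw [OpenPartialHomeomorph.trans_source] at hy
          exact hy.2)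
    refine hcomp.congr fun y hy => ?_
    rw [OpenPartialHomeomorph.trans_source] at hy
    have hy₁ : y ∈ (e.symm.trans e').source := hy.1
    rw [OpenPartialHomeomorph.trans_source] at hy₁
    show e'' (e.symm y) = e'' (e'.symm (e' (e.symm y)))
    rw [e'.left_inv hy₁.2]

/-- In particular, Whitehead compatibility with the `C^∞` atlas `cDIFF` of a smooth manifold
`(M, cDIFF)` passes to any atlas contained in its maximal `C^∞` atlas
`IsManifold.maximalAtlas (𝓡 n) ∞ M`. [cite: Munkres1966, §8] -/
theorem IsWhiteheadCompatible.of_subset_isManifoldMaximalAtlas {M : Type*} [TopologicalSpace M]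
    [cDIFF : ChartedSpace (EuclideanSpace ℝ (Fin n)) M] [IsManifold (𝓡 n) ∞ M]
    {cPL : ChartedSpace (EuclideanSpace ℝ (Fin n)) M} (h : IsWhiteheadCompatible n M cPL cDIFF)
    (cDIFF' : ChartedSpace (EuclideanSpace ℝ (Fin n)) M)
    (h' : @atlas (EuclideanSpace ℝ (Fin n)) _ M _ cDIFF' ⊆
      @IsManifold.maximalAtlas ℝ _ _ _ _ _ _ (𝓡 n) ∞ M _ cDIFF) :
    IsWhiteheadCompatible n M cPL cDIFF' :=
  h.of_subset_maximalAtlas h'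

end MaximalAtlas

/-! ### PD after PL: Whitehead compatibility is a property of the PL structure -/

section ChainTriangulation

open Literature.Analysis.Convexity Literature.Analysis.Convexity.SignArrangement

variable {E F : Type*} [NormedAddCommGroup E] [NormedSpace ℝ E] [FiniteDimensional ℝ E]
  [NormedAddCommGroup F] [NormedSpace ℝ F] [FiniteDimensional ℝ F]

/-- **Chain triangulation of a simplex adapted to two finite families of simplices.** Let `S`
be finitely many simplices (affinely independent finsets) of `E` covering the full simplex
`Δ = convexHull D`, let `A s` (`s ∈ S`) be affine maps `E → F` mapping `Δ ∩ s` into the union of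
finitely many simplices `T` of `F`. Then `Δ` is the underlying space of a finite simplicial
complex `P` each of whose closed simplices lies in a single simplex `s ∈ S` and is mapped by
the corresponding `A s` into a single simplex of `T`. (`P` is the chain triangulation
`SignArrangement.exists_simplicialComplex` of the arrangement of the barycentric-coordinate
functionals of `D`, of affine bases through the members of `S`, and of affine bases through the
members of `T` pulled back by the maps `A s`; membership in a simplex is a sign condition on
these functionals. This is the structural content of
`exists_simplicialComplex_comp_affine` of `PLManifoldComp`, with the same proof; stated for
families of simplices that need not form complexes, so that it applies to the top-dimensional
simplices of a complex and to smooth rather than affine pieces on the target side.)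
Rourke–Sanderson (1972), 2.14 (common subdivisions), here without subdivision theory.
[folklore] -/
theorem exists_simplicialComplex_forall_subset_mapsTo
    {S : Set (Finset E)} (hSfin : S.Finite) (hSind : ∀ s ∈ S, AffineIndependent ℝ ((↑) : s → E))
    (A : Finset E → E →ᵃ[ℝ] F)
    {T : Set (Finset F)} (hTfin : T.Finite) (hTind : ∀ t ∈ T, AffineIndependent ℝ ((↑) : t → F))
    {D : Finset E} (hDind : AffineIndependent ℝ ((↑) : D → E))
    (hDtot : affineSpan ℝ (D : Set E) = ⊤)
    (hDS : convexHull ℝ (D : Set E) ⊆ ⋃ s ∈ S, convexHull ℝ (s : Set E))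
    (hDT : ∀ s ∈ S, ∀ x ∈ convexHull ℝ (D : Set E), x ∈ convexHull ℝ (s : Set E) →
      A s x ∈ ⋃ t ∈ T, convexHull ℝ (t : Set F)) :
    ∃ P : Geometry.SimplicialComplex ℝ E, P.faces.Finite ∧ P.space = convexHull ℝ (D : Set E) ∧
      ∀ τ ∈ P.faces, ∃ s ∈ S, convexHull ℝ (τ : Set E) ⊆ convexHull ℝ (s : Set E) ∧
        ∃ t ∈ T, MapsTo (A s) (convexHull ℝ (τ : Set E)) (convexHull ℝ (t : Set F)) := by
  classical
  -- the affine basis `δ` on `D`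
  have hDrange : Set.range ((↑) : D → E) = (D : Set E) := Subtype.range_coe
  let δ : AffineBasis ↥D ℝ E := ⟨(↑), hDind, by rw [hDrange]; exact hDtot⟩
  -- affine bases through the members of `S` and of `T`
  have hB : ∀ s : ↥hSfin.toFinset, ∃ B : Set E, ((s : Finset E) : Set E) ⊆ B ∧
      AffineIndependent ℝ ((↑) : B → E) ∧ affineSpan ℝ B = ⊤ := fun s =>
    exists_subset_affineIndependent_affineSpan_eq_top (hSind _ (hSfin.mem_toFinset.1 s.2))
  choose B hBs hBind hBtot using hB
  have hB' : ∀ t : ↥hTfin.toFinset, ∃ B' : Set F, ((t : Finset F) : Set F) ⊆ B' ∧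
      AffineIndependent ℝ ((↑) : B' → F) ∧ affineSpan ℝ B' = ⊤ := fun t =>
    exists_subset_affineIndependent_affineSpan_eq_top (hTind _ (hTfin.mem_toFinset.1 t.2))
  choose B' hB't hB'ind hB'tot using hB'
  haveI hBfin : ∀ s, Finite (B s) := fun s =>
    (finite_set_of_fin_dim_affineIndependent ℝ (hBind s)).to_subtype
  haveI hB'fin : ∀ t, Finite (B' t) := fun t =>
    (finite_set_of_fin_dim_affineIndependent ℝ (hB'ind t)).to_subtype
  let β : ∀ s, AffineBasis ↥(B s) ℝ E := fun s =>
    ⟨(↑), hBind s, by rw [Subtype.range_coe]; exact hBtot s⟩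
  let γ : ∀ t, AffineBasis ↥(B' t) ℝ F := fun t =>
    ⟨(↑), hB'ind t, by rw [Subtype.range_coe]; exact hB'tot t⟩
  -- the functionals of the arrangement
  let ι : Type _ := ↥D ⊕ ((Σ s : ↥hSfin.toFinset, ↥(B s)) ⊕
    (Σ p : ↥hSfin.toFinset × ↥hTfin.toFinset, ↥(B' p.2)))
  haveI : Finite ι := by
    dsimp only [ι]
    infer_instance
  let Lf : ι → E →ᵃ[ℝ] ℝ := Sum.elim (fun i => δ.coord i)
    (Sum.elim (fun σ => (β σ.1).coord σ.2) fun σ => ((γ σ.1.2).coord σ.2).comp (A σ.1.1))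
  haveI : Fintype ι := Fintype.ofFinite ι
  -- the admissible sign vectors (nonempty faces inside `Δ`) and chosen points
  let Φ : Finset (ι → SignType) := Finset.univ.filter fun ε =>
    (face Lf ε).Nonempty ∧ ∀ i : ↥D, ε (Sum.inl i) = 0 ∨ ε (Sum.inl i) = 1
  let b : (ι → SignType) → E := fun ε => if h : (face Lf ε).Nonempty then h.some else 0
  have hb : ∀ ε ∈ Φ, b ε ∈ face Lf ε := fun ε hε => by
    have h := (Finset.mem_filter.1 hε).2.1
    simp only [b, dif_pos h]
    exact h.some_mem
  -- `Δ` and the closed faces of `Φ`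
  have hΔ : convexHull ℝ (D : Set E) = {x | ∀ i : ↥D, 0 ≤ δ.coord i x} := by
    rw [← δ.convexHull_eq_nonneg_coord]
    congr 1
    exact hDrange.symm
  have hcl_sub : ∀ ε ∈ Φ, cl Lf ε ⊆ convexHull ℝ (D : Set E) := fun ε hε y hy => by
    rw [hΔ]
    intro i
    have hεi := (Finset.mem_filter.1 hε).2.2 i
    have hyi : SignType.sign (δ.coord i y) = 0 ∨ SignType.sign (δ.coord i y) = ε (Sum.inl i) :=
      hy (Sum.inl i)
    rcases hyi with h | h
    · exact (sign_eq_zero_iff.1 h).ge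
    · rcases hεi with h' | h'
      · rw [h'] at h
        exact (sign_eq_zero_iff.1 h).ge
      · rw [h'] at h
        exact (sign_eq_one_iff.1 h).le
  have hdown : ∀ ε ∈ Φ, ∀ ε', SLE ε' ε → (face Lf ε').Nonempty → ε' ∈ Φ :=
    fun ε hε ε' hle hne => Finset.mem_filter.2 ⟨Finset.mem_univ _, hne, fun i => by
      rcases hle (Sum.inl i) with h | h
      · exact Or.inl h
      · rw [h]
        exact (Finset.mem_filter.1 hε).2.2 i⟩
  have hbdd : ∀ ε ∈ Φ, Bornology.IsBounded (cl Lf ε) := fun ε hε =>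
    (D.finite_toSet.isCompact_convexHull ℝ).isBounded.subset (hcl_sub ε hε)
  obtain ⟨P, hPfin, hPface, hPcl⟩ := exists_simplicialComplex Lf Φ b hb hdown hbdd
  -- the underlying space of `P` is `Δ`
  have hspace : P.space = convexHull ℝ (D : Set E) := by
    refine Subset.antisymm (fun x hx => ?_) (fun x hx => ?_)
    · obtain ⟨t, ht, hxt⟩ := Geometry.SimplicialComplex.mem_space_iff.1 hx
      obtain ⟨ε, hε, hsub⟩ := hPcl t ht
      exact hcl_sub ε hε (hsub hxt)
    · have hx' := hx
      rw [hΔ] at hx'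
      have hεΦ : svec Lf x ∈ Φ := Finset.mem_filter.2 ⟨Finset.mem_univ _, ⟨x, rfl⟩, fun i => by
        rcases (hx' i).lt_or_eq with h | h
        · exact Or.inr (sign_pos h)
        · refine Or.inl ?_
          show SignType.sign (δ.coord i x) = 0
          rw [← h, sign_zero]⟩
      exact hPface _ hεΦ (mem_face_svec x)
  refine ⟨P, hPfin, hspace, fun τ hτ => ?_⟩
  obtain ⟨ε, hε, hτcl⟩ := hPcl τ hτ
  -- the chosen point `b ε` locates a simplex of `S` containing the closed face of `ε`
  have hx₀ : b ε ∈ face Lf ε := hb ε hε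
  have hx₀Δ : b ε ∈ convexHull ℝ (D : Set E) := hcl_sub ε hε (face_subset_cl hx₀)
  obtain ⟨s, hs, hx₀s⟩ := mem_iUnion₂.1 (hDS hx₀Δ)
  let σ : ↥hSfin.toFinset := ⟨s, hSfin.mem_toFinset.2 hs⟩
  have himg : ((s : Finset E) : Set E) = (β σ) '' {j : ↥(B σ) | (j : E) ∈ s} := by
    ext x
    constructor
    · intro hx
      exact ⟨⟨x, hBs σ hx⟩, hx, rfl⟩
    · rintro ⟨j, hj, rfl⟩
      exact hj
  have hcl_s : cl Lf ε ⊆ convexHull ℝ (s : Set E) := fun y hy => by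
    rw [himg] at hx₀s ⊢
    refine mem_convexHull_image_affineBasis_of_sign (β σ) _ hx₀s fun j => ?_
    have hεj : ε (Sum.inr (Sum.inl ⟨σ, j⟩)) = SignType.sign ((β σ).coord j (b ε)) :=
      (congr_fun hx₀ (Sum.inr (Sum.inl ⟨σ, j⟩))).symm
    have := hy (Sum.inr (Sum.inl ⟨σ, j⟩))
    rw [hεj] at this
    exact this
  -- and `A s` maps the closed face into one simplex of `T`
  have hz₀ : A s (b ε) ∈ ⋃ t ∈ T, convexHull ℝ (t : Set F) := hDT s hs _ hx₀Δ hx₀s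
  obtain ⟨t', ht', hz₀t⟩ := mem_iUnion₂.1 hz₀
  let τ' : ↥hTfin.toFinset := ⟨t', hTfin.mem_toFinset.2 ht'⟩
  have himg' : ((t' : Finset F) : Set F) = (γ τ') '' {j : ↥(B' τ') | (j : F) ∈ t'} := by
    ext z
    constructor
    · intro hz
      exact ⟨⟨z, hB't τ' hz⟩, hz, rfl⟩
    · rintro ⟨j, hj, rfl⟩
      exact hj
  have hA_t : ∀ y ∈ cl Lf ε, A s y ∈ convexHull ℝ (t' : Set F) := fun y hy => by
    rw [himg'] at hz₀t ⊢
    refine mem_convexHull_image_affineBasis_of_sign (γ τ') _ hz₀t fun j => ?_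
    have hεj : ε (Sum.inr (Sum.inr ⟨(σ, τ'), j⟩)) =
        SignType.sign ((γ τ').coord j (A s (b ε))) :=
      (congr_fun hx₀ (Sum.inr (Sum.inr ⟨(σ, τ'), j⟩))).symm
    have := hy (Sum.inr (Sum.inr ⟨(σ, τ'), j⟩))
    rw [hεj] at this
    exact this
  exact ⟨s, hs, hτcl.trans hcl_s, t', ht', fun x hx => hA_t x (hτcl hx)⟩

/-- **Interior points of a finite complex lie in top-dimensional simplices.** If `x` is an
interior point of the underlying space of a finite simplicial complex `K` in `E`, then `x` lies
in the closed simplex of a face of `K` affinely spanning `E`: the closed simplices of the other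
faces are closed with empty interior, so their (finite) union has empty interior
(`Literature.Analysis.Convexity.interior_biUnion_finset_eq_empty`) and does not contribute to the
interior of `K.space`. [folklore] -/
theorem exists_mem_faces_affineSpan_eq_top_of_mem_interior {K : Geometry.SimplicialComplex ℝ E}
    (hfin : K.faces.Finite) {x : E} (hx : x ∈ interior K.space) :
    ∃ s ∈ K.faces, affineSpan ℝ (s : Set E) = ⊤ ∧ x ∈ convexHull ℝ (s : Set E) := by
  classical
  set Top : Finset (Finset E) := hfin.toFinset.filter fun s => affineSpan ℝ (s : Set E) = ⊤
    with hTop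
  set Low : Finset (Finset E) := hfin.toFinset.filter fun s => ¬ affineSpan ℝ (s : Set E) = ⊤
    with hLow
  have hsplit : K.space =
      (⋃ s ∈ Top, convexHull ℝ (s : Set E)) ∪ ⋃ s ∈ Low, convexHull ℝ (s : Set E) := by
    refine Subset.antisymm (fun y hy => ?_) (union_subset ?_ ?_)
    · obtain ⟨s, hs, hys⟩ := Geometry.SimplicialComplex.mem_space_iff.1 hy
      by_cases h : affineSpan ℝ (s : Set E) = ⊤
      · exact Or.inl (mem_iUnion₂.2 ⟨s, Finset.mem_filter.2 ⟨hfin.mem_toFinset.2 hs, h⟩, hys⟩)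
      · exact Or.inr (mem_iUnion₂.2 ⟨s, Finset.mem_filter.2 ⟨hfin.mem_toFinset.2 hs, h⟩, hys⟩)
    · exact iUnion₂_subset fun s hs =>
        Geometry.SimplicialComplex.convexHull_subset_space
          (hfin.mem_toFinset.1 (Finset.mem_filter.1 hs).1)
    · exact iUnion₂_subset fun s hs =>
        Geometry.SimplicialComplex.convexHull_subset_space
          (hfin.mem_toFinset.1 (Finset.mem_filter.1 hs).1)
  have hlow : interior (⋃ s ∈ Low, convexHull ℝ (s : Set E)) = ∅ :=
    interior_biUnion_finset_eq_empty Low (fun s => convexHull ℝ (s : Set E))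
      (fun s _ => s.finite_toSet.isClosed_convexHull ℝ) fun s hs =>
        Set.not_nonempty_iff_eq_empty.1 fun hne =>
          (Finset.mem_filter.1 hs).2 (interior_convexHull_nonempty_iff_affineSpan_eq_top.1 hne)
  have hclosed : IsClosed (⋃ s ∈ Top, convexHull ℝ (s : Set E)) :=
    isClosed_biUnion_finset fun s _ => s.finite_toSet.isClosed_convexHull ℝ
  rw [hsplit, interior_union_isClosed_of_interior_empty hclosed hlow] at hx
  obtain ⟨s, hs, hxs⟩ := mem_iUnion₂.1 (interior_subset hx)
  exact ⟨s, hfin.mem_toFinset.1 (Finset.mem_filter.1 hs).1, (Finset.mem_filter.1 hs).2, hxs⟩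

omit [FiniteDimensional ℝ E] [FiniteDimensional ℝ F] in
/-- An affine map which is injective on a set with nonempty interior has injective linear
part (move a little from an interior point in the direction of a kernel vector). [folklore] -/
theorem injective_linear_of_injOn {A : E →ᵃ[ℝ] F} {w : Set E} (hw : (interior w).Nonempty)
    (hinj : InjOn A w) : Injective A.linear := by
  obtain ⟨x, hx⟩ := hw
  rw [← LinearMap.ker_eq_bot, LinearMap.ker_eq_bot']
  intro v hv
  have hcont : Continuous fun t : ℝ => t • v + x :=
    (continuous_id.smul continuous_const).add continuous_const
  have hmem : ∀ᶠ t in 𝓝 (0 : ℝ), t • v + x ∈ interior w := by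
    refine hcont.continuousAt.eventually_mem ?_
    simpa using isOpen_interior.mem_nhds hx
  obtain ⟨t, ht, ht0⟩ : ∃ t : ℝ, t • v + x ∈ interior w ∧ t ≠ 0 :=
    ((hmem.filter_mono nhdsWithin_le_nhds).and self_mem_nhdsWithin).exists (f := 𝓝[≠] (0 : ℝ))
  have hA : A (t • v + x) = A x := by
    have h := A.map_vadd x (t • v)
    rwa [vadd_eq_add, vadd_eq_add, map_smul, hv, smul_zero, zero_add] at h
  have heq : t • v + x = x := hinj (interior_subset ht) (interior_subset hx) hA
  have h0 : t • v = 0 := by simpa using heq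
  exact (smul_eq_zero.1 h0).resolve_left ht0

end ChainTriangulation

section CompPL

/-- **PD after PL is PD** (Hirsch–Mazur (1974), Part I, §3: the two definitions of a
smoothing of a PL manifold — via all charts of the PL structure, or via one triangulation —
agree; Munkres (1966), §8: a non-degenerate `C^∞` map of a complex stays non-degenerate on
every subdivision). Let `f` be PD (piecewise differentiable of maximal rank) on `v`, and let
`p` be PL and injective on the open set `u`. Then `f ∘ p` is PD on `u ∩ p ⁻¹' v`: around `a`, take
a finite complex `K ∋ a` with `p` affine (`= A s`) on its simplices and a finite complex
`L ∋ p a` with `f` a smooth immersion (`= G t`) on its simplices, a small simplex `Δ ∋ a`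
inside `interior K.space ∩ p ⁻¹' L.space` (`exists_affineIndependent_convexHull_subset`), and
the chain triangulation of `Δ` adapted to the *top-dimensional* simplices of `K` (which cover
`Δ`, `exists_mem_faces_affineSpan_eq_top_of_mem_interior`) and to `L`
(`exists_simplicialComplex_forall_subset_mapsTo`): on each of its simplices
`f ∘ p = G t ∘ A s`, and `A s` has injective linear part because `p` is injective on the
top-dimensional simplex `s` (`injective_linear_of_injOn`). [cite: HirschMazur1974, Part I §3] -/
theorem IsPDOn.comp_isPLOn {f p : EuclideanSpace ℝ (Fin n) → EuclideanSpace ℝ (Fin n)}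
    {u v : Set (EuclideanSpace ℝ (Fin n))} (hf : IsPDOn n f v) (hp : IsPLOn n n p u)
    (hu : IsOpen u) (hinj : InjOn p u) : IsPDOn n (f ∘ p) (u ∩ p ⁻¹' v) := by
  classical
  rintro a ⟨hau, hav⟩
  obtain ⟨K, hKfin, hKa, hKu, hK⟩ := hp a hau
  obtain ⟨L, hLfin, hLa, hLv, hL⟩ := hf (p a) hav
  choose! A hA using hK
  choose! G hG using hL
  have hpc : ContinuousAt p a := hp.continuousOn.continuousAt (hu.mem_nhds hau)
  have hN : interior K.space ∩ p ⁻¹' L.space ∈ 𝓝 a :=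
    inter_mem (isOpen_interior.mem_nhds (mem_interior_iff_mem_nhds.2 hKa))
      (hpc.preimage_mem_nhds hLa)
  obtain ⟨D, hDind, hDtot, hDnhds, hDN⟩ := exists_affineIndependent_convexHull_subset hN
  -- the top-dimensional simplices of `K` cover `Δ = convexHull D`
  set S : Set (Finset (EuclideanSpace ℝ (Fin n))) :=
    {s | s ∈ K.faces ∧ affineSpan ℝ (s : Set (EuclideanSpace ℝ (Fin n))) = ⊤} with hS
  have hSfin : S.Finite := hKfin.subset fun s hs => hs.1
  have hDS : convexHull ℝ (D : Set (EuclideanSpace ℝ (Fin n))) ⊆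
      ⋃ s ∈ S, convexHull ℝ (s : Set (EuclideanSpace ℝ (Fin n))) := fun x hx => by
    obtain ⟨s, hs, htop, hxs⟩ :=
      exists_mem_faces_affineSpan_eq_top_of_mem_interior hKfin (hDN hx).1
    exact mem_iUnion₂.2 ⟨s, ⟨hs, htop⟩, hxs⟩
  have hDT : ∀ s ∈ S, ∀ x ∈ convexHull ℝ (D : Set (EuclideanSpace ℝ (Fin n))),
      x ∈ convexHull ℝ (s : Set (EuclideanSpace ℝ (Fin n))) →
      A s x ∈ ⋃ t ∈ L.faces, convexHull ℝ (t : Set (EuclideanSpace ℝ (Fin n))) :=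
    fun s hs x hxD hxs => by
      have h : p x ∈ L.space := (hDN hxD).2
      rw [hA s hs.1 hxs] at h
      obtain ⟨t, ht, hxt⟩ := Geometry.SimplicialComplex.mem_space_iff.1 h
      exact mem_iUnion₂.2 ⟨t, ht, hxt⟩
  obtain ⟨P, hPfin, hPspace, hP⟩ := exists_simplicialComplex_forall_subset_mapsTo hSfin
    (fun s hs => K.indep hs.1) A hLfin (fun t ht => L.indep ht) hDind hDtot hDS hDT
  refine ⟨P, hPfin, ?_, ?_, fun τ hτ => ?_⟩
  · rw [hPspace]
    exact hDnhds
  · rw [hPspace]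
    exact fun x hx => ⟨hKu (interior_subset (hDN hx).1), hLv (hDN hx).2⟩
  obtain ⟨s, hs, hτs, t, ht, hmaps⟩ := hP τ hτ
  obtain ⟨hGt, hfG, hGinj⟩ := hG t ht
  -- the affine piece `A s` as a continuous affine map; its linear part is injective
  set Ac : EuclideanSpace ℝ (Fin n) →ᴬ[ℝ] EuclideanSpace ℝ (Fin n) :=
    ⟨A s, (A s).continuous_of_finiteDimensional⟩ with hAc
  have hsu : convexHull ℝ (s : Set (EuclideanSpace ℝ (Fin n))) ⊆ u :=
    (Geometry.SimplicialComplex.convexHull_subset_space hs.1).trans hKu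
  have hinjA : InjOn (A s) (convexHull ℝ (s : Set (EuclideanSpace ℝ (Fin n)))) :=
    fun x hx y hy hxy => hinj (hsu hx) (hsu hy) (by rw [hA s hs.1 hx, hA s hs.1 hy]; exact hxy)
  have hlin : Injective (A s).linear :=
    injective_linear_of_injOn (interior_convexHull_nonempty_iff_affineSpan_eq_top.2 hs.2) hinjA
  refine ⟨G t ∘ Ac, hGt.comp Ac.contDiff, fun x hx => ?_, fun x hx => ?_⟩
  · show f (p x) = G t (A s x)
    rw [hA s hs.1 (hτs hx)]
    exact hfG (hmaps hx)
  · rw [fderiv_comp x (hGt.contDiffAt.differentiableAt (by simp)) Ac.differentiableAt,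
      Ac.fderiv, ContinuousLinearMap.coe_comp]
    refine (hGinj (A s x) (hmaps hx)).comp ?_
    rw [ContinuousAffineMap.coe_contLinear]
    exact hlin

/-- **A PL homeomorphism is PD**: a map which is PL and injective on an open set `u` is
piecewise differentiable of maximal rank on `u` (`IsPDOn.comp_isPLOn` with `f := id`).
Munkres (1966), §8 (a linear isomorphism on each simplex is an immersion of the simplex).
[folklore] -/
theorem isPDOn_of_isPLOn_injOn {p : EuclideanSpace ℝ (Fin n) → EuclideanSpace ℝ (Fin n)}
    {u : Set (EuclideanSpace ℝ (Fin n))} (hp : IsPLOn n n p u) (hu : IsOpen u)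
    (hinj : InjOn p u) : IsPDOn n p u := by
  simpa only [Function.id_comp, preimage_univ, inter_univ] using
    (isPDOn_id (n := n) isOpen_univ).comp_isPLOn hp hu hinj

variable (hcomp : IsPLOn.comp (n := n)) (haff : isPLOn_affineMap (n := n) (m := n))

/-- PD after a member of the PL groupoid is PD: if `f` is PD on `v` and `e ∈ plGroupoid n`
(a PL homeomorphism between open subsets of `ℝⁿ`), then `f ∘ e` is PD on
`e.source ∩ e ⁻¹' v`. [cite: HirschMazur1974, Part I §3] -/
theorem IsPDOn.comp_of_mem_plGroupoid {f : EuclideanSpace ℝ (Fin n) → EuclideanSpace ℝ (Fin n)}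
    {v : Set (EuclideanSpace ℝ (Fin n))} (hf : IsPDOn n f v)
    {e : OpenPartialHomeomorph (EuclideanSpace ℝ (Fin n)) (EuclideanSpace ℝ (Fin n))}
    (he : e ∈ plGroupoid n hcomp haff) : IsPDOn n (f ∘ e) (e.source ∩ e ⁻¹' v) :=
  hf.comp_isPLOn ((mem_plGroupoid_iff n hcomp haff).1 he).1 e.open_source e.injOn

/-- Members of the PL groupoid (PL homeomorphisms between open subsets of `ℝⁿ`) are PD on
their source. [folklore] -/
theorem isPDOn_of_mem_plGroupoid
    {e : OpenPartialHomeomorph (EuclideanSpace ℝ (Fin n)) (EuclideanSpace ℝ (Fin n))}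
    (he : e ∈ plGroupoid n hcomp haff) : IsPDOn n e e.source :=
  isPDOn_of_isPLOn_injOn ((mem_plGroupoid_iff n hcomp haff).1 he).1 e.open_source e.injOn

/-- **Whitehead compatibility only depends on the PL structure.** Let the PL atlas `cPL` be
Whitehead compatible with `cDIFF` on `M`, and let `cPL'` be another atlas all of whose charts
lie in the maximal atlas of `cPL` for the PL groupoid (e.g. any PL atlas defining the same PL
structure, or the maximal PL atlas itself). Then `cPL'` is Whitehead compatible with `cDIFF`:
locally `e' ∘ e₁.symm = (e' ∘ e.symm) ∘ (e ∘ e₁.symm)` with `e` a chart of `cPL`, a PD map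
after a PL homeomorphism (`IsPDOn.comp_isPLOn`). This is the equivalence of the two
definitions of a smoothing in Hirsch–Mazur (1974), Part I, §3 (compatibility with the maximal
PL atlas versus with one PL atlas / triangulation); together with
`IsWhiteheadCompatible.of_subset_maximalAtlas`, Whitehead compatibility is a relation between
the PL structure and the smooth structure, independent of the atlases presenting them. All
three atlases are passed explicitly. [cite: HirschMazur1974, Part I §3] -/
theorem IsWhiteheadCompatible.of_subset_plMaximalAtlas {M : Type*} [TopologicalSpace M]
    {cPL cPL' cDIFF : ChartedSpace (EuclideanSpace ℝ (Fin n)) M}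
    (h : IsWhiteheadCompatible n M cPL cDIFF)
    (h' : @atlas (EuclideanSpace ℝ (Fin n)) _ M _ cPL' ⊆
      @StructureGroupoid.maximalAtlas (EuclideanSpace ℝ (Fin n)) M _ _ cPL
        (plGroupoid n hcomp haff)) :
    IsWhiteheadCompatible n M cPL' cDIFF := by
  intro e₁ he₁ e' he'
  refine IsPDOn.of_forall_exists fun x hx => ?_
  -- `x ∈ e₁.target`, `e₁.symm x ∈ e'.source`; interpose the `cPL`-chart `e` at `e₁.symm x`
  have hx₁ : x ∈ e₁.target := hx.1
  have hx₂ : e₁.symm x ∈ e'.source := hx.2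
  obtain ⟨e, he, hxe⟩ : ∃ e ∈ @atlas (EuclideanSpace ℝ (Fin n)) _ M _ cPL,
      e₁.symm x ∈ e.source :=
    ⟨@chartAt (EuclideanSpace ℝ (Fin n)) _ M _ cPL (e₁.symm x),
      @chart_mem_atlas (EuclideanSpace ℝ (Fin n)) M _ _ cPL (e₁.symm x),
      @mem_chart_source (EuclideanSpace ℝ (Fin n)) M _ _ cPL (e₁.symm x)⟩
  have hT₀ : e₁.symm.trans e ∈ plGroupoid n hcomp haff := (h' he₁ e he).1
  have hT₁ : IsPDOn n (e' ∘ e.symm) (e.symm.trans e').source := h e he e' he'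
  have hPD : IsPDOn n ((e' ∘ e.symm) ∘ (e₁.symm.trans e))
      ((e₁.symm.trans e).source ∩ (e₁.symm.trans e) ⁻¹' (e.symm.trans e').source) :=
    hT₁.comp_of_mem_plGroupoid hcomp haff hT₀
  refine ⟨(e₁.symm.trans e).source ∩ (e₁.symm.trans e) ⁻¹' (e.symm.trans e').source,
    ?_, ?_, ?_⟩
  · intro y hy
    have hy₁ : y ∈ (e₁.symm.trans e).source := hy.1
    have hy₂ : (e₁.symm.trans e) y ∈ (e.symm.trans e').source := hy.2
    rw [OpenPartialHomeomorph.trans_source] at hy₁ hy₂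
    refine ⟨hy₁.1, ?_⟩
    have h₃ : e.symm (e (e₁.symm y)) ∈ e'.source := hy₂.2
    rwa [e.left_inv hy₁.2] at h₃
  · simp only [OpenPartialHomeomorph.trans_source, mem_inter_iff, mem_preimage,
      OpenPartialHomeomorph.coe_trans, comp_apply, OpenPartialHomeomorph.symm_source]
    refine ⟨⟨hx₁, hxe⟩, OpenPartialHomeomorph.map_source _ hxe, ?_⟩
    rw [e.left_inv hxe]
    exact hx₂
  · refine hPD.congr fun y hy => ?_
    have hy₁ : y ∈ (e₁.symm.trans e).source := hy.1
    rw [OpenPartialHomeomorph.trans_source] at hy₁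
    show e' (e₁.symm y) = e' (e.symm (e (e₁.symm y)))
    rw [e.left_inv hy₁.2]

/-- **Whitehead compatibility is a relation between structures.** If `cPL` is Whitehead
compatible with `cDIFF`, then so is every atlas `cPL'` inside the maximal PL atlas of `cPL`
with every atlas `cDIFF'` inside the maximal `C^∞` atlas of `cDIFF`
(`IsWhiteheadCompatible.of_subset_plMaximalAtlas` and
`IsWhiteheadCompatible.of_subset_maximalAtlas` combined): the relation descends to
(PL structure, smooth structure) pairs, as in Hirsch–Mazur (1974), Part I, §3, where both
structures are maximal atlases. [cite: HirschMazur1974, Part I §3] -/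
theorem IsWhiteheadCompatible.of_subset_maximalAtlases {M : Type*} [TopologicalSpace M]
    {cPL cPL' cDIFF cDIFF' : ChartedSpace (EuclideanSpace ℝ (Fin n)) M}
    (h : IsWhiteheadCompatible n M cPL cDIFF)
    (hPL : @atlas (EuclideanSpace ℝ (Fin n)) _ M _ cPL' ⊆
      @StructureGroupoid.maximalAtlas (EuclideanSpace ℝ (Fin n)) M _ _ cPL
        (plGroupoid n hcomp haff))
    (hDIFF : @atlas (EuclideanSpace ℝ (Fin n)) _ M _ cDIFF' ⊆
      @StructureGroupoid.maximalAtlas (EuclideanSpace ℝ (Fin n)) M _ _ cDIFF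
        (contDiffGroupoid ∞ (𝓡 n))) :
    IsWhiteheadCompatible n M cPL' cDIFF' :=
  (h.of_subset_plMaximalAtlas hcomp haff hPL).of_subset_maximalAtlas hDIFF

end CompPL

end Literature.Topology.FourManifolds
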